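import Mathlib
import Summits.KontsevichZagierPeriods.Zeta5Search.Families.BasicGrowth
import HarnessLib

/-!
# ζ(5) search — Families: BOUNDARY DECAY of Brown's function — `f_σ ≤ g_w / len_e ≤ (ℓ+1)·(any gap)` for convergent `σ`

HONEST FRAMING: systematic search; no irrationality claim unless certified.  STRUCTURAL facts about the size of
Brown's basic cellular integrals [Brown2016, §1.5 (1.3)–(1.4)] (seat P2, Families layer); nothing about the
arithmetic of any zeta value.

`Families/BasicMonotone.lean` proved `f_σ ≤ 1` from a Hall MATCHING of the finite `σδ⁰`-edges to the gaps they span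
(`exists_gap_matching`: `#{e : span e ⊆ L} ≤ |L|` for every gap set `L`).  For a CONVERGENT seating the count is
STRICT on proper gap sets — this is exactly the analytic criterion `Crit` of the basic form `ω_σ`
(`crit_of_brownConvergent` at exponents `(0,0)`): **`#{e : span e ⊆ L} ≤ |L| − 1`** for every non-empty `L` of at
most `ℓ` gaps (`card_filter_span_subset_lt`).  A strict Hall count is a matching with one degree of freedom:
* `exists_deficient_matching` — for EVERY finite edge `e₀` and EVERY gap `w₀` there is an injective assignment of a
  spanned gap `≠ w₀` to every finite edge `≠ e₀`;
* **`fSigma_le_gapN_div_len`** — hence `f_σ(t) ≤ gapN t w₀ / len_t(e₀)` for all `w₀`, `e₀` (write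
  `f_σ = (g_{w₀}/len_{e₀}) · ∏_{e ≠ e₀} g_{m e}/len_e` along the completed bijection and bound the matched factors by
  `1`);
* **`fSigma_le_mul_gapN`** — some finite edge spans a gap `≥ 1/(ℓ+1)`, so **`f_σ(t) ≤ (ℓ+1) · gapN t w`** for every
  gap `w`: Brown's function tends to zero at the boundary of the simplex, linearly in the smallest gap
  (`fSigma_lt_of_gapN_lt`).
This is the input for the EXISTENCE OF A MAXIMISER of `f_σ` (compactness of the thick part of the simplex) and
for the critical-point / capacity-duality analysis of `M_σ = sup f_σ` in the sequel files.  Standard axioms only.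
-/

noncomputable section

open MeasureTheory Set Finset Filter Topology

namespace Summit.KontsevichZagierPeriods.Zeta5Search.Families.Cellular

variable {ℓ : ℕ} (σ : Fin (ℓ + 3) → Fin (ℓ + 3))

/-! ### The strict Hall count for convergent seatings -/

/-- **Strict Hall count.**  For a bijective CONVERGENT seating, every non-empty set `L` of at most `ℓ` gaps contains
the spans of fewer than `|L|` finite `σδ⁰`-edges: `#{e : span e ⊆ L} < |L|`.  (This is the block criterion `Crit`
of the basic form `ω_σ`, i.e. Brown's convergence condition read on the divisors at finite distance.)
[Brown2016, §1.5, Lemma 3.6] -/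
theorem card_filter_span_subset_lt (hσ : Function.Bijective σ) (hc : Convergent σ) (L : Finset (Fin (ℓ + 1)))
    (hne : L.Nonempty) (hL : L.card ≤ ℓ) :
    (univ.filter fun i : SEdge σ => (cellEdges σ hσ.1).span (Sum.inr i) ⊆ L).card < L.card := by
  classical
  have hcrit : (cellEdges σ hσ.1).Crit (cellExp σ (fun _ => (0 : ℤ)) (fun _ => (0 : ℤ))) :=
    crit_of_brownConvergent σ _ _ hσ (homogeneous_const σ 0) (brownConvergent_basic_of_convergent hσ hc le_rfl)
  have hpos := (cellEdges σ hσ.1).blockSum_pos_of_crit' hcrit L hne hL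
  unfold EdgeFamily.blockSum at hpos
  rw [Finset.sum_filter, Fintype.sum_sum_type] at hpos
  have hD : ∑ i : DEdge ℓ, (if (cellEdges σ hσ.1).span (Sum.inl i) ⊆ L
      then cellExp σ (fun _ => (0 : ℤ)) (fun _ => (0 : ℤ)) (Sum.inl i) else 0) = 0 :=
    Finset.sum_eq_zero fun i _ => by simp [cellExp]
  have hS : ∑ i : SEdge σ, (if (cellEdges σ hσ.1).span (Sum.inr i) ⊆ L
      then cellExp σ (fun _ => (0 : ℤ)) (fun _ => (0 : ℤ)) (Sum.inr i) else 0) =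
      -((univ.filter fun i : SEdge σ => (cellEdges σ hσ.1).span (Sum.inr i) ⊆ L).card : ℝ) := by
    rw [← Finset.sum_filter]
    have h1 : ∀ i ∈ univ.filter (fun i : SEdge σ => (cellEdges σ hσ.1).span (Sum.inr i) ⊆ L),
        cellExp σ (fun _ => (0 : ℤ)) (fun _ => (0 : ℤ)) (Sum.inr i) = -1 := fun i _ => by simp [cellExp]
    rw [Finset.sum_congr rfl h1, Finset.sum_const, nsmul_eq_mul, mul_neg, mul_one]
  rw [hD, hS, zero_add] at hpos
  have : ((univ.filter fun i : SEdge σ => (cellEdges σ hσ.1).span (Sum.inr i) ⊆ L).card : ℝ) < L.card := by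
    linarith
  exact_mod_cast this

/-- The finite `σδ⁰`-edges other than a fixed one are `ℓ` in number. -/
theorem card_sEdge_ne (hσ : Function.Bijective σ) (e0 : SEdge σ) : Fintype.card {i : SEdge σ // i ≠ e0} = ℓ := by
  classical
  rw [Fintype.card_subtype_compl, card_sEdge σ hσ, Fintype.card_subtype_eq]
  rfl

/-- **Deficiency-one matching.**  For a bijective convergent seating, ANY finite edge `e₀` and ANY gap `w₀`: the
finite edges `e ≠ e₀` admit an injective choice of a spanned gap `m e ∈ span e` avoiding `w₀`. -/
theorem exists_deficient_matching (hσ : Function.Bijective σ) (hc : Convergent σ) (e0 : SEdge σ)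
    (w0 : Fin (ℓ + 1)) :
    ∃ m : {i : SEdge σ // i ≠ e0} → Fin (ℓ + 1), Function.Injective m ∧
      ∀ i, m i ≠ w0 ∧ m i ∈ (cellEdges σ hσ.1).span (Sum.inr i.1) := by
  classical
  have key : ∀ s : Finset {i : SEdge σ // i ≠ e0},
      s.card ≤ (s.biUnion fun i => ((cellEdges σ hσ.1).span (Sum.inr i.1)).erase w0).card := by
    intro s
    set L := s.biUnion fun i => ((cellEdges σ hσ.1).span (Sum.inr i.1)).erase w0 with hLdef
    -- every edge of `s` has its span inside `insert w0 L`
    have h1 : s.card ≤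
        (univ.filter fun i : SEdge σ => (cellEdges σ hσ.1).span (Sum.inr i) ⊆ insert w0 L).card := by
      refine Finset.card_le_card_of_injOn (fun i => i.1) (fun i hi => ?_) (fun _ _ _ _ h => Subtype.ext h)
      simp only [Finset.coe_filter, Finset.mem_univ, true_and, Set.mem_setOf_eq]
      intro w hw
      by_cases hww : w = w0
      · rw [hww]; exact Finset.mem_insert_self _ _
      · refine Finset.mem_insert_of_mem ?_
        rw [hLdef, Finset.mem_biUnion]
        exact ⟨i, hi, Finset.mem_erase.2 ⟨hww, hw⟩⟩
    have hins : (insert w0 L).card ≤ L.card + 1 := Finset.card_insert_le _ _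
    by_cases hfull : (insert w0 L).card ≤ ℓ
    · have := card_filter_span_subset_lt σ hσ hc (insert w0 L) (Finset.insert_nonempty _ _) hfull
      omega
    · -- `insert w0 L` is everything, so `L` has at least `ℓ` elements, while `s` has at most `ℓ`
      have hsc : s.card ≤ ℓ := (Finset.card_le_univ s).trans (card_sEdge_ne σ hσ e0).le
      omega
  obtain ⟨m, hm, hmem⟩ := (Finset.all_card_le_biUnion_card_iff_exists_injective _).1 key
  exact ⟨m, hm, fun i => Finset.mem_erase.1 (hmem i)⟩

/-! ### The boundary bound `f_σ ≤ g_{w₀} / len_{e₀}` -/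

/-- **Boundary bound.**  For a bijective convergent seating, every gap `w₀`, every finite `σδ⁰`-edge `e₀` and every
point `t` of the open simplex: `f_σ(t) ≤ gapN t w₀ / len_t(e₀)`. -/
theorem fSigma_le_gapN_div_len (hσ : Function.Bijective σ) (hc : Convergent σ) {t : Fin ℓ → ℝ}
    (ht : t ∈ openSimplex ℓ) (w0 : Fin (ℓ + 1)) (e0 : SEdge σ) :
    fSigma σ t ≤ gapN t w0 / (cellEdges σ hσ.1).len t (Sum.inr e0) := by
  classical
  obtain ⟨m, hm, hmw⟩ := exists_deficient_matching σ hσ hc e0 w0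
  set E := cellEdges σ hσ.1 with hE
  have hpos := (mem_openSimplex_iff_gapN t).1 ht
  have hlen : ∀ i : SEdge σ, 0 < E.len t (Sum.inr i) := fun i => E.len_pos ht _
  -- complete `m` to a map on all finite edges sending `e0 ↦ w0`
  let M : SEdge σ → Fin (ℓ + 1) := fun i => if h : i = e0 then w0 else m ⟨i, h⟩
  have hMe0 : M e0 = w0 := by simp [M]
  have hMne : ∀ (i : SEdge σ) (h : i ≠ e0), M i = m ⟨i, h⟩ := fun i h => by simp [M, h]
  have hMinj : Function.Injective M := by
    intro i j hij
    by_cases hi : i = e0 <;> by_cases hj : j = e0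
    · rw [hi, hj]
    · exfalso
      rw [hi, hMe0, hMne j hj] at hij
      exact (hmw ⟨j, hj⟩).1 hij.symm
    · exfalso
      rw [hj, hMe0, hMne i hi] at hij
      exact (hmw ⟨i, hi⟩).1 hij
    · rw [hMne i hi, hMne j hj] at hij
      exact congrArg Subtype.val (hm hij)
  have hMbij : Function.Bijective M :=
    (Fintype.bijective_iff_injective_and_card M).2 ⟨hMinj, by rw [card_sEdge σ hσ, Fintype.card_fin]⟩
  let eM : SEdge σ ≃ Fin (ℓ + 1) := Equiv.ofBijective M hMbij
  have hden : 0 < formDen σ t := Finset.prod_pos fun i _ => ef_pos ht fun e => succ_ne_self i (hσ.1 e)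
  unfold fSigma
  rw [prod_ef_succ_eq_prod_gapN, formDen_eq_prod_len σ hσ ht, ← Equiv.prod_comp eM (fun w => gapN t w)]
  change (∏ i : SEdge σ, gapN t (M i)) / ∏ i : SEdge σ, E.len t (Sum.inr i) ≤ gapN t w0 / E.len t (Sum.inr e0)
  rw [Fintype.prod_eq_mul_prod_compl e0 (fun i : SEdge σ => gapN t (M i)),
    Fintype.prod_eq_mul_prod_compl e0 (fun i : SEdge σ => E.len t (Sum.inr i)), hMe0,
    mul_div_mul_comm, ← Finset.prod_div_distrib]
  refine mul_le_of_le_one_right (div_nonneg (hpos w0).le (hlen e0).le) ?_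
  refine Finset.prod_le_one (fun i _ => div_nonneg (hpos _).le (hlen i).le) fun i hi => ?_
  have hi' : i ≠ e0 := by simpa using hi
  rw [div_le_one (hlen i), hMne i hi', E.len_eq_sum_gap]
  exact Finset.single_le_sum (fun w _ => (hpos w).le) (hmw ⟨i, hi'⟩).2

/-! ### Consequences: linear decay in every gap -/

/-- Every gap lies in the span of some finite `σδ⁰`-edge (a gap matching is a bijection). -/
theorem exists_sEdge_mem_span (hσ : Function.Bijective σ) (w : Fin (ℓ + 1)) :
    ∃ i : SEdge σ, w ∈ (cellEdges σ hσ.1).span (Sum.inr i) := by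
  obtain ⟨e, he⟩ := exists_gap_equiv σ hσ
  exact ⟨e.symm w, by simpa using he (e.symm w)⟩

/-- Some gap of a point of the open simplex is at least `1/(ℓ+1)` (the `ℓ+1` gaps sum to `1`). -/
theorem exists_inv_le_gapN (t : Fin ℓ → ℝ) : ∃ w : Fin (ℓ + 1), 1 / ((ℓ : ℝ) + 1) ≤ gapN t w := by
  classical
  have hsum : ∑ w : Fin (ℓ + 1), gapN t w = 1 := by
    rw [Fin.sum_univ_eq_sum_range (fun w => gapN t w) (ℓ + 1)]
    exact sum_gapN t
  have hconst : ∑ _w : Fin (ℓ + 1), (1 / ((ℓ : ℝ) + 1)) = 1 := by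
    rw [Finset.sum_const, Finset.card_univ, Fintype.card_fin, nsmul_eq_mul]
    push_cast
    field_simp
  have hle : ∑ _w : Fin (ℓ + 1), (1 / ((ℓ : ℝ) + 1)) ≤ ∑ w : Fin (ℓ + 1), gapN t w := by rw [hconst, hsum]
  obtain ⟨w, -, hw⟩ := Finset.exists_le_of_sum_le Finset.univ_nonempty hle
  exact ⟨w, hw⟩

/-- Some finite `σδ⁰`-edge has length at least `1/(ℓ+1)` at `t`. -/
theorem exists_inv_le_len (hσ : Function.Bijective σ) {t : Fin ℓ → ℝ} (ht : t ∈ openSimplex ℓ) :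
    ∃ i : SEdge σ, 1 / ((ℓ : ℝ) + 1) ≤ (cellEdges σ hσ.1).len t (Sum.inr i) := by
  obtain ⟨w, hw⟩ := exists_inv_le_gapN t
  obtain ⟨i, hi⟩ := exists_sEdge_mem_span σ hσ w
  refine ⟨i, hw.trans ?_⟩
  rw [(cellEdges σ hσ.1).len_eq_sum_gap]
  exact Finset.single_le_sum (fun w' _ => ((mem_openSimplex_iff_gapN t).1 ht w').le) hi

/-- **Linear boundary decay.**  For a bijective convergent seating, at every point of the open simplex and for EVERY
gap `w`: `f_σ(t) ≤ (ℓ + 1) · gapN t w`.  In particular `f_σ → 0` at the boundary of the simplex. -/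
theorem fSigma_le_mul_gapN (hσ : Function.Bijective σ) (hc : Convergent σ) {t : Fin ℓ → ℝ}
    (ht : t ∈ openSimplex ℓ) (w : Fin (ℓ + 1)) : fSigma σ t ≤ ((ℓ : ℝ) + 1) * gapN t w := by
  obtain ⟨i, hi⟩ := exists_inv_le_len σ hσ ht
  have hpos := (mem_openSimplex_iff_gapN t).1 ht
  have hl : (0 : ℝ) < 1 / ((ℓ : ℝ) + 1) := by positivity
  calc fSigma σ t ≤ gapN t w / (cellEdges σ hσ.1).len t (Sum.inr i) := fSigma_le_gapN_div_len σ hσ hc ht w i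
    _ ≤ gapN t w / (1 / ((ℓ : ℝ) + 1)) := div_le_div_of_nonneg_left (hpos w).le hl hi
    _ = ((ℓ : ℝ) + 1) * gapN t w := by rw [div_div_eq_mul_div, div_one, mul_comm]

/-- If some gap is `< c/(ℓ+1)` then `f_σ < c`: away from the value `c`, Brown's function lives on the thick part
of the simplex. -/
theorem fSigma_lt_of_gapN_lt (hσ : Function.Bijective σ) (hc : Convergent σ) {t : Fin ℓ → ℝ}
    (ht : t ∈ openSimplex ℓ) {c : ℝ} {w : Fin (ℓ + 1)} (hw : gapN t w < c / ((ℓ : ℝ) + 1)) :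
    fSigma σ t < c := by
  have hl : (0 : ℝ) < (ℓ : ℝ) + 1 := by positivity
  calc fSigma σ t ≤ ((ℓ : ℝ) + 1) * gapN t w := fSigma_le_mul_gapN σ hσ hc ht w
    _ < ((ℓ : ℝ) + 1) * (c / ((ℓ : ℝ) + 1)) := mul_lt_mul_of_pos_left hw hl
    _ = c := mul_div_cancel₀ c hl.ne'

/-- On the superlevel set `{f_σ ≥ c}` every gap is at least `c/(ℓ+1)`. -/
theorem gapN_ge_of_le_fSigma (hσ : Function.Bijective σ) (hc : Convergent σ) {t : Fin ℓ → ℝ}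
    (ht : t ∈ openSimplex ℓ) {c : ℝ} (hct : c ≤ fSigma σ t) (w : Fin (ℓ + 1)) :
    c / ((ℓ : ℝ) + 1) ≤ gapN t w := by
  by_contra h
  exact absurd hct (not_le.2 (fSigma_lt_of_gapN_lt σ hσ hc ht (not_le.1 h)))

end Summit.KontsevichZagierPeriods.Zeta5Search.Families.Cellular
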